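import Literature.NumberTheory.LFunctions.RodgersTaoWeakEnergyAssemblyProofs
import HarnessLib

/-!
# Rodgers–Tao 2020, Prop. 6.1 (weak bound on integrated energy) — RH-FREE CONTENT twin, Part V:
# the block-general form `[J, κJ]_{ℤ*}`

RH-FREE literature proofs (no definitions, no named facts, no `sorry`). Trunk T-ANT
(`Literature/NumberTheory/LFunctions`). Companion of `RodgersTaoWeakEnergyAssemblyProofs.lean`
(p446714), which proves the CONTENT twin of Rodgers–Tao 2020 Prop. 15 (= v4 Prop. 6.1) for the
printed block `[J, 2J]_{ℤ*}`. The §7 consumer of Prop. 15 —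

> FMP p. 42: "This is clearly non-negative, and from Proposition 15, (66), (68), and Fubini's theorem
> we see that `Ẽ_T` is absolutely integrable in time (in particular, it is finite for almost every
> `Λ/2 ≤ t ≤ 0`)." —

sums over ALL pairs `j ≠ k`, and a pair `j < k ≤ 2j` lies in one block `[2^i, 4·2^i]` but not
always in a block `[J, 2J]`; this file therefore re-runs the parameter bookkeeping of Part IV for an
arbitrary ratio `κ ≥ 2` (block `[⌈J⌉, ⌊κJ⌋]_{ℤ*}`, `N = ⌊(κ+1)J⌋`, thresholds with `log((κ+2)J)`).
The mathematics is that of Part IV verbatim (the chain lemma `three_mul_integral_le_of_chain` there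
is already block-general); only the constants change (`M₀` picks up `(κ+1)² (log(κ+1) + 1)³`).

## Main results (0 new facts)

* `rodgers_tao_weak_energy_bound_block_of` — for `t₀ < t₁ < t₂`, `H_{t₀}` real-rooted, the location
  law (50) on `[t₁, t₂]`, and `κ ≥ 2`: `∃ M₀ ≥ 0, α (= 3), ∀ J ≥ 1,
  ∫_{t₁}^{t₂} Σ_{[⌈J⌉, ⌊κJ⌋]_{ℤ*}.offDiag} E_{jk}(t) dt ≤ M₀ J² log₊^α J`;
* `rodgers_tao_weak_energy_bound_block_of_far` — the same with the far-field constant explicit;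
* `growth_of_large_block`, `chain_rhs_le_block` — the two bookkeeping lemmas with `N ≤ κ₁ J`.

bears_on: N-C/N-P (COLUMN 3 DBN). WHAT THIS IS NOT: RH-free bookkeeping above a real-rooted time;
the printed `Λ/2 ≤ t ≤ 0` instance of Prop. 15 is VACUOUS-AS-PRINTED; nothing here bears on the
truth of RH.

## References

* B. Rodgers, T. Tao, Forum Math. Pi 8 (2020) e6, Prop. 15 pp. 38–39 (= arXiv:1801.05914v5
  Prop. 6.1), §7 p. 42 (the Fubini consumer).
-/

noncomputable section

open Set Filter Topology MeasureTheory intervalIntegral Real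

namespace Literature.NumberTheory.LFunctions

/-- `log 8 > 2`. [folklore] -/
private theorem two_lt_log_eight_aux : (2 : ℝ) < Real.log 8 := by
  have he := Real.exp_one_lt_d9
  have h : Real.exp 2 < 8 := by
    rw [show (2 : ℝ) = 1 + 1 by norm_num, Real.exp_add]; nlinarith [Real.exp_pos 1]
  calc (2 : ℝ) = Real.log (Real.exp 2) := (Real.log_exp 2).symm
    _ < Real.log 8 := Real.log_lt_log (Real.exp_pos 2) h

/-- `C log(κ'J)⁷ < J` for all large `J` (`log⁷ = o(id)`). [folklore] -/
private theorem exists_mul_log_mul_pow_seven_lt (C : ℝ) {κ' : ℝ} (hκ' : 1 ≤ κ') :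
    ∃ J₁ : ℝ, ∀ J : ℝ, J₁ ≤ J → 2 ≤ J → C * Real.log (κ' * J) ^ 7 < J := by
  have h := (Real.isLittleO_pow_log_id_atTop (n := 7)).bound
    (show (0 : ℝ) < 1 / (2 * κ' * (|C| + 1)) by positivity)
  obtain ⟨X, hX⟩ := Filter.eventually_atTop.1 h
  refine ⟨|X|, fun J hJ hJ2 ↦ ?_⟩
  have hκJ : J ≤ κ' * J := by nlinarith
  have hb := hX (κ' * J) (by linarith [le_abs_self X])
  have hlog : 0 ≤ Real.log (κ' * J) := Real.log_nonneg (by linarith)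
  rw [Real.norm_eq_abs, Real.norm_eq_abs, id, abs_of_pos (by linarith : (0 : ℝ) < κ' * J),
    abs_of_nonneg (pow_nonneg hlog 7)] at hb
  have h1 : C * Real.log (κ' * J) ^ 7 ≤ (|C| + 1) * Real.log (κ' * J) ^ 7 :=
    mul_le_mul_of_nonneg_right (by linarith [le_abs_self C]) (pow_nonneg hlog 7)
  have h2 : (|C| + 1) * Real.log (κ' * J) ^ 7 ≤ (|C| + 1) * (1 / (2 * κ' * (|C| + 1)) * (κ' * J)) :=
    mul_le_mul_of_nonneg_left hb (by positivity)
  have h3 : (|C| + 1) * (1 / (2 * κ' * (|C| + 1)) * (κ' * J)) = J / 2 := by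
    field_simp
  linarith

/-- Arithmetic helper for `growth_of_large`: the exponent comparison. [folklore] -/
private theorem growth_expo_aux {X b A' : ℝ} (hX1 : 1 ≤ X) (hb : 0 ≤ b) (hA' : 0 ≤ A') :
    2 * X + 2 * (12 + 2 * b * X) + 2 * (A' * (X ^ 2 * (1 + X))) ≤ (26 + 4 * b + 4 * A') * X ^ 3 := by
  have hX0 : 0 ≤ X := by linarith
  have hX2 : 1 ≤ X ^ 2 := one_le_pow₀ hX1
  have hX3 : X ≤ X ^ 3 := by
    calc X = X * 1 := by ring
      _ ≤ X * X ^ 2 := mul_le_mul_of_nonneg_left hX2 hX0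
      _ = X ^ 3 := by ring
  have hX23 : X ^ 2 ≤ X ^ 3 := by
    calc X ^ 2 = X ^ 2 * 1 := by ring
      _ ≤ X ^ 2 * X := mul_le_mul_of_nonneg_left hX1 (sq_nonneg X)
      _ = X ^ 3 := by ring
  have h13 : (1 : ℝ) ≤ X ^ 3 := le_trans hX1 hX3
  have p1 := mul_le_mul_of_nonneg_left hX3 hb
  have p2 := mul_le_mul_of_nonneg_left hX23 hA'
  have e : (26 + 4 * b + 4 * A') * X ^ 3 = 26 * X ^ 3 + 4 * (b * X ^ 3) + 4 * (A' * X ^ 3) := by ring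
  have e2 : 2 * X + 2 * (12 + 2 * b * X) + 2 * (A' * (X ^ 2 * (1 + X))) =
      24 + 2 * X + 4 * (b * X) + 2 * (A' * X ^ 2) + 2 * (A' * X ^ 3) := by ring
  rw [e, e2]
  linarith

/-- Arithmetic helper for `growth_of_large`: the polylog threshold. [folklore] -/
private theorem growth_mid_aux {X Y D c L J : ℝ} (hX1 : 1 ≤ X) (hD : 1 ≤ D) (hc : 0 ≤ c) (hL0 : 0 ≤ L)
    (hL2 : L ≤ 2 * D * X ^ 2) (hXY : X ^ 7 ≤ Y)
    (hbig : (4 + 4 * D + 64 * D ^ 2 * c) * Y < J) :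
    2 + L + 8 * L ^ 2 * (c * X ^ 3) < J / 2 := by
  have h17 : (1 : ℝ) ≤ X ^ 7 := one_le_pow₀ hX1
  have hX27 : X ^ 2 ≤ X ^ 7 := pow_le_pow_right₀ hX1 (by norm_num)
  have hLsq : L ^ 2 ≤ 4 * D ^ 2 * X ^ 4 := by nlinarith
  have e1 : 8 * L ^ 2 * (c * X ^ 3) ≤ 32 * D ^ 2 * c * X ^ 7 := by
    have := mul_le_mul_of_nonneg_right hLsq (by positivity : 0 ≤ c * X ^ 3)
    nlinarith
  have e2 : L ≤ 2 * D * X ^ 7 := hL2.trans (mul_le_mul_of_nonneg_left hX27 (by positivity))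
  have hD0 : 0 ≤ D := by linarith
  nlinarith [mul_le_mul_of_nonneg_left hXY hD0, mul_le_mul_of_nonneg_left hXY (by positivity : 0 ≤ D ^ 2 * c)]

/-- Arithmetic helper for `growth_of_large`: from the threshold to `c X³ < m/(8L)`. [folklore] -/
private theorem growth_key_aux {X c L J m : ℝ} (hL0 : 0 < L) (hmid : 2 + L + 8 * L ^ 2 * (c * X ^ 3) < J / 2)
    (hm : (J / 2 - 2) / L - 1 ≤ m) : c * X ^ 3 < m / (8 * L) := by
  have hm' : ((J / 2 - 2) / L - 1) / (8 * L) ≤ m / (8 * L) :=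
    div_le_div_of_nonneg_right hm (by positivity)
  refine lt_of_lt_of_le ?_ hm'
  rw [lt_div_iff₀ (by positivity), div_sub_one hL0.ne', lt_div_iff₀ hL0]
  have e : c * X ^ 3 * (8 * L) * L = 8 * L ^ 2 * (c * X ^ 3) := by ring
  rw [e]
  linarith

/-- **The growth comparison** (house form of "The ratio between `Q_{[0.5J,3J]}` and `Q_{[J,2J]}` is
thus less than `(1+J^{−0.1})^{0.5J/J^{0.1}}`", p. 38, with steps of length `L ≍ log² J` and ratio
`1 + 1/(4L)` instead of `J^{0.1}` and `1 + J^{−0.1}`): for `J` beyond an explicit polylog threshold,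
`N² G_N² e^{2A'ℓ(N)} < (1 + 1/(4L))^m`. [cite: RodgersTaoFMP2020, Prop. 15 proof p. 38] -/
theorem growth_of_large_block {B' A' C₀ D J κ₁ : ℝ} {N L m : ℕ} (hB' : 0 ≤ B') (hA' : 0 ≤ A')
    (hC₀ : 0 < C₀) (hD : 1 ≤ D)
    (hordN : logPlus (classicalLocation N) ≤ C₀ * logPlus N)
    (hN6 : 6 ≤ N) (hNJ : (N : ℝ) ≤ κ₁ * J) (hJ : 4 ≤ J)
    (hL1 : 1 ≤ L) (hL : (L : ℝ) ≤ D * logPlus N ^ 2 + 1)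
    (hm : (J / 2 - 2) / L - 1 ≤ m)
    (hbig : (4 + 4 * D + 64 * D ^ 2 * (26 + 4 * B' * C₀ + 4 * A')) * Real.log ((κ₁ + 1) * J) ^ 7 < J) :
    (N : ℝ) ^ 2 * (4 * π + 2 * B' * logPlus (classicalLocation N)) ^ 2 *
        Real.exp (2 * (A' * (logPlus N ^ 2 * logPlus (logPlus N)))) < (1 + 1 / (4 * L)) ^ m := by
  set X : ℝ := logPlus N with hXdef
  have hN0 : (0 : ℝ) ≤ N := Nat.cast_nonneg N
  have hN6' : (6 : ℝ) ≤ N := by exact_mod_cast hN6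
  have hX : X = Real.log (2 + N) := by rw [hXdef, logPlus, abs_of_nonneg hN0]
  have hX2 : 2 < X := by
    rw [hX]
    exact two_lt_log_eight_aux.trans_le (Real.log_le_log (by norm_num) (by linarith))
  have hX1 : 1 ≤ X := by linarith
  have hexpX : Real.exp X = 2 + N := by rw [hX, Real.exp_log (by linarith)]
  have hXJ : X ≤ Real.log ((κ₁ + 1) * J) := by
    rw [hX]; exact Real.log_le_log (by linarith) (by nlinarith)
  -- the pieces of the left-hand side
  set c₆ : ℝ := 26 + 4 * B' * C₀ + 4 * A' with hc₆
  have hBC : 0 ≤ B' * C₀ := mul_nonneg hB' hC₀.le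
  have hG : 4 * π + 2 * B' * logPlus (classicalLocation N) ≤ Real.exp (12 + 2 * B' * C₀ * X) := by
    have h1 : 2 * B' * logPlus (classicalLocation N) ≤ 2 * B' * (C₀ * X) :=
      mul_le_mul_of_nonneg_left hordN (by positivity)
    have h2 : 12 + 2 * B' * C₀ * X + 1 ≤ Real.exp (12 + 2 * B' * C₀ * X) := Real.add_one_le_exp _
    nlinarith [Real.pi_lt_d2]
  have hG0 : 0 < 4 * π + 2 * B' * logPlus (classicalLocation N) := by
    have := mul_nonneg (mul_nonneg zero_le_two hB') (logPlus_nonneg (classicalLocation (N : ℝ)))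
    positivity
  have hN2 : (N : ℝ) ^ 2 ≤ Real.exp (2 * X) := by
    rw [show 2 * X = X + X by ring, Real.exp_add, hexpX]; nlinarith
  have hG2 : (4 * π + 2 * B' * logPlus (classicalLocation N)) ^ 2 ≤
      Real.exp (2 * (12 + 2 * B' * C₀ * X)) := by
    rw [show 2 * (12 + 2 * B' * C₀ * X) = (12 + 2 * B' * C₀ * X) + (12 + 2 * B' * C₀ * X) by ring,
      Real.exp_add, sq]
    exact mul_le_mul hG hG hG0.le (Real.exp_pos _).le
  have hllX : logPlus X ≤ 1 + X := by
    rw [logPlus, abs_of_nonneg (by linarith)]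
    linarith [Real.log_le_sub_one_of_pos (by linarith : (0 : ℝ) < 2 + X)]
  have hℓ : A' * (logPlus N ^ 2 * logPlus (logPlus N)) ≤ A' * (X ^ 2 * (1 + X)) := by
    rw [← hXdef]
    exact mul_le_mul_of_nonneg_left (mul_le_mul_of_nonneg_left hllX (sq_nonneg X)) hA'
  have hLHS : (N : ℝ) ^ 2 * (4 * π + 2 * B' * logPlus (classicalLocation N)) ^ 2 *
      Real.exp (2 * (A' * (logPlus N ^ 2 * logPlus (logPlus N)))) ≤ Real.exp (c₆ * X ^ 3) := by
    have h1 : (N : ℝ) ^ 2 * (4 * π + 2 * B' * logPlus (classicalLocation N)) ^ 2 *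
        Real.exp (2 * (A' * (logPlus N ^ 2 * logPlus (logPlus N)))) ≤
        Real.exp (2 * X) * Real.exp (2 * (12 + 2 * B' * C₀ * X)) * Real.exp (2 * (A' * (X ^ 2 * (1 + X)))) := by
      have e3 : Real.exp (2 * (A' * (logPlus N ^ 2 * logPlus (logPlus N)))) ≤
          Real.exp (2 * (A' * (X ^ 2 * (1 + X)))) := Real.exp_le_exp.2 (by linarith)
      exact mul_le_mul (mul_le_mul hN2 hG2 (sq_nonneg _) (Real.exp_pos _).le) e3
        (Real.exp_pos _).le (mul_nonneg (Real.exp_pos _).le (Real.exp_pos _).le)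
    refine h1.trans ?_
    rw [← Real.exp_add, ← Real.exp_add, Real.exp_le_exp]
    have h := growth_expo_aux hX1 hBC hA' (X := X)
    rw [hc₆]
    have e : 2 * (12 + 2 * (B' * C₀) * X) = 2 * (12 + 2 * B' * C₀ * X) := by ring
    rw [e] at h
    have e' : (26 + 4 * (B' * C₀) + 4 * A') * X ^ 3 = (26 + 4 * B' * C₀ + 4 * A') * X ^ 3 := by ring
    rw [e'] at h
    linarith
  -- the right-hand side
  have hL0 : (0 : ℝ) < L := by exact_mod_cast hL1
  have hu0 : (0 : ℝ) ≤ 1 / (4 * L) := by positivity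
  have hu1 : 1 / (4 * (L : ℝ)) ≤ 1 := by
    rw [div_le_one (by positivity)]; linarith [show (1 : ℝ) ≤ L by exact_mod_cast hL1]
  have hRHS : Real.exp ((m : ℝ) / (8 * L)) ≤ (1 + 1 / (4 * L)) ^ m := by
    have := exp_half_mul_le_one_add_pow hu0 hu1 m
    rwa [show (m : ℝ) * (1 / (4 * L)) / 2 = m / (8 * L) by field_simp; ring] at this
  -- `c₆ X³ < m/(8L)`
  have hDX : 1 ≤ D * X ^ 2 := by nlinarith
  have hL2 : (L : ℝ) ≤ 2 * D * X ^ 2 := by linarith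
  have hX7 : X ^ 7 ≤ Real.log ((κ₁ + 1) * J) ^ 7 := pow_le_pow_left₀ (by linarith) hXJ 7
  have hc₆0 : 0 ≤ c₆ := by rw [hc₆]; positivity
  have hmid : 2 + (L : ℝ) + 8 * L ^ 2 * (c₆ * X ^ 3) < J / 2 :=
    growth_mid_aux hX1 hD hc₆0 hL0.le hL2 hX7 hbig
  have hkey : c₆ * X ^ 3 < (m : ℝ) / (8 * L) := growth_key_aux hL0 hmid hm
  calc (N : ℝ) ^ 2 * (4 * π + 2 * B' * logPlus (classicalLocation N)) ^ 2 *
        Real.exp (2 * (A' * (logPlus N ^ 2 * logPlus (logPlus N))))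
      ≤ Real.exp (c₆ * X ^ 3) := hLHS
    _ < Real.exp ((m : ℝ) / (8 * L)) := Real.exp_lt_exp.2 hkey
    _ ≤ (1 + 1 / (4 * L)) ^ m := hRHS

/-- The right-hand side of `three_mul_integral_le_of_chain` is `≪ J² log₊³ J` for `N ≤ 3J`.
[cite: RodgersTaoFMP2020, Prop. 15 proof p. 39 ("We conclude that `Q_K ≪ J² log^{O(1)} J`")] -/
theorem chain_rhs_le_block {B' A' C₀ C J τ κ₁ : ℝ} {N : ℕ} (hB' : 0 ≤ B') (hA' : 0 ≤ A') (hC₀ : 0 < C₀)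
    (hC : 0 ≤ C) (hτ : 0 ≤ τ) (hJ : 2 ≤ J) (hκ₁ : 3 ≤ κ₁) (hN6 : 6 ≤ N) (hNJ : (N : ℝ) ≤ κ₁ * J)
    (hξN : classicalLocation N ≤ C₀ * (N / logPlus N))
    (hordN : logPlus (classicalLocation N) ≤ C₀ * logPlus N) :
    (N : ℝ) ^ 2 * (A' * (logPlus N ^ 2 * logPlus (logPlus N)) +
          Real.log (2 * (classicalLocation N + B' * logPlus (classicalLocation N)))) +
        4 * (N : ℝ) ^ 2 * C * τ ≤
      3 * ((κ₁ ^ 2 * (Real.log κ₁ + 1) ^ 3 / 3 * (2 * A' + (|Real.log (2 * C₀ * (1 + B'))| + 1) + 4 * C * τ)) *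
        J ^ 2 * logPlus J ^ 3) := by
  set X : ℝ := logPlus N with hXdef
  have hN0 : (0 : ℝ) ≤ N := Nat.cast_nonneg N
  have hN6' : (6 : ℝ) ≤ N := by exact_mod_cast hN6
  have hX : X = Real.log (2 + N) := by rw [hXdef, logPlus, abs_of_nonneg hN0]
  have hX2 : 2 < X := by
    rw [hX]
    exact two_lt_log_eight_aux.trans_le (Real.log_le_log (by norm_num) (by linarith))
  have hX1 : 1 ≤ X := by linarith
  have hX0 : 0 ≤ X := by linarith
  have hexpX : Real.exp X = 2 + N := by rw [hX, Real.exp_log (by linarith)]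
  have hX3 : X ≤ X ^ 3 := by
    calc X = X * 1 := by ring
      _ ≤ X * X ^ 2 := mul_le_mul_of_nonneg_left (one_le_pow₀ hX1) hX0
      _ = X ^ 3 := by ring
  have h13 : (1 : ℝ) ≤ X ^ 3 := le_trans hX1 hX3
  -- `ℓ(N) ≤ 2X³`
  have hllX : logPlus X ≤ 1 + X := by
    rw [logPlus, abs_of_nonneg hX0]
    linarith [Real.log_le_sub_one_of_pos (by linarith : (0 : ℝ) < 2 + X)]
  have hℓ : logPlus N ^ 2 * logPlus (logPlus N) ≤ 2 * X ^ 3 := by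
    rw [← hXdef]
    calc X ^ 2 * logPlus X ≤ X ^ 2 * (1 + X) := mul_le_mul_of_nonneg_left hllX (sq_nonneg X)
      _ = X ^ 2 + X ^ 3 := by ring
      _ ≤ 2 * X ^ 3 := by nlinarith
  -- `log D_N ≤ c₇ X³`
  set c₇ : ℝ := |Real.log (2 * C₀ * (1 + B'))| + 1 with hc₇
  have hξpos : 0 < classicalLocation (N : ℝ) := classicalLocation_pos (by linarith)
  have hξle : classicalLocation (N : ℝ) ≤ C₀ * N := by
    refine hξN.trans (mul_le_mul_of_nonneg_left (div_le_self hN0 hX1) hC₀.le)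
  have hDN : 2 * (classicalLocation N + B' * logPlus (classicalLocation N)) ≤
      2 * C₀ * (1 + B') * Real.exp X := by
    rw [hexpX]
    have h1 : B' * logPlus (classicalLocation N) ≤ B' * (C₀ * X) := mul_le_mul_of_nonneg_left hordN hB'
    have hXN : X ≤ 2 + N := by
      rw [hX]; linarith [Real.log_le_sub_one_of_pos (by linarith : (0 : ℝ) < 2 + N)]
    have hBC : 0 ≤ B' * C₀ := mul_nonneg hB' hC₀.le
    nlinarith [mul_le_mul_of_nonneg_left hXN hBC, mul_le_mul_of_nonneg_left (by linarith : (N : ℝ) ≤ 2 + N) hC₀.le]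
  have hDpos : 0 < 2 * (classicalLocation N + B' * logPlus (classicalLocation N)) := by
    have := mul_nonneg hB' (logPlus_nonneg (classicalLocation (N : ℝ)))
    positivity
  have hK0 : 0 < 2 * C₀ * (1 + B') := by positivity
  have hlogD : Real.log (2 * (classicalLocation N + B' * logPlus (classicalLocation N))) ≤ c₇ * X ^ 3 := by
    calc Real.log (2 * (classicalLocation N + B' * logPlus (classicalLocation N)))
        ≤ Real.log (2 * C₀ * (1 + B') * Real.exp X) := Real.log_le_log hDpos hDN
      _ = Real.log (2 * C₀ * (1 + B')) + X := by
          rw [Real.log_mul hK0.ne' (Real.exp_pos X).ne', Real.log_exp]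
      _ ≤ |Real.log (2 * C₀ * (1 + B'))| * X ^ 3 + X ^ 3 := by
          have h1 := le_abs_self (Real.log (2 * C₀ * (1 + B')))
          have h2 : |Real.log (2 * C₀ * (1 + B'))| ≤ |Real.log (2 * C₀ * (1 + B'))| * X ^ 3 :=
            le_mul_of_one_le_right (abs_nonneg _) h13
          linarith
      _ = c₇ * X ^ 3 := by rw [hc₇]; ring
  -- `X ≤ (log κ₁ + 1) log₊ J`
  have hκ0 : 0 < κ₁ := by linarith
  have hlogκ : 0 ≤ Real.log κ₁ := Real.log_nonneg (by linarith)
  have hLJ : 1 ≤ logPlus J := by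
    rw [logPlus, abs_of_nonneg (by linarith)]
    have : Real.exp 1 ≤ 2 + J := by linarith [Real.exp_one_lt_d9]
    calc (1 : ℝ) = Real.log (Real.exp 1) := (Real.log_exp 1).symm
      _ ≤ Real.log (2 + J) := Real.log_le_log (Real.exp_pos 1) this
  have hXJ : X ≤ (Real.log κ₁ + 1) * logPlus J := by
    have h1 : X ≤ Real.log κ₁ + logPlus J := by
      rw [hX, logPlus, abs_of_nonneg (by linarith), ← Real.log_mul hκ0.ne' (by linarith)]
      exact Real.log_le_log (by linarith) (by nlinarith)
    nlinarith
  set ℓ : ℝ := (Real.log κ₁ + 1) with hℓdef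
  have hℓ1 : 1 ≤ ℓ := by rw [hℓdef]; linarith
  have hX3J : X ^ 3 ≤ ℓ ^ 3 * logPlus J ^ 3 := by
    rw [← mul_pow]; exact pow_le_pow_left₀ hX0 hXJ 3
  have hN2 : (N : ℝ) ^ 2 ≤ κ₁ ^ 2 * J ^ 2 := by
    rw [← mul_pow]; exact pow_le_pow_left₀ hN0 hNJ 2
  have hc₇0 : 0 ≤ c₇ := by rw [hc₇]; positivity
  -- assemble
  have hin : A' * (logPlus N ^ 2 * logPlus (logPlus N)) +
      Real.log (2 * (classicalLocation N + B' * logPlus (classicalLocation N))) ≤ (2 * A' + c₇) * X ^ 3 := by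
    have p := mul_le_mul_of_nonneg_left hℓ hA'
    have e : (2 * A' + c₇) * X ^ 3 = A' * (2 * X ^ 3) + c₇ * X ^ 3 := by ring
    rw [e]
    linarith
  have hin0 : 0 ≤ (2 * A' + c₇) * X ^ 3 := by positivity
  have hCt : 4 * (N : ℝ) ^ 2 * C * τ ≤ 4 * (κ₁ ^ 2 * J ^ 2) * (C * τ) * X ^ 3 := by
    have hCτ : 0 ≤ C * τ := mul_nonneg hC hτ
    have p := mul_le_mul_of_nonneg_right hN2 hCτ
    have q : 4 * (κ₁ ^ 2 * J ^ 2) * (C * τ) ≤ 4 * (κ₁ ^ 2 * J ^ 2) * (C * τ) * X ^ 3 :=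
      le_mul_of_one_le_right (by positivity) h13
    have e : 4 * (N : ℝ) ^ 2 * C * τ = 4 * ((N : ℝ) ^ 2 * (C * τ)) := by ring
    rw [e]
    linarith
  have hJ2 : 0 ≤ J ^ 2 := sq_nonneg J
  calc (N : ℝ) ^ 2 * (A' * (logPlus N ^ 2 * logPlus (logPlus N)) +
          Real.log (2 * (classicalLocation N + B' * logPlus (classicalLocation N)))) + 4 * (N : ℝ) ^ 2 * C * τ
      ≤ (κ₁ ^ 2 * J ^ 2) * ((2 * A' + c₇) * X ^ 3) + 4 * (κ₁ ^ 2 * J ^ 2) * (C * τ) * X ^ 3 := by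
        have p1 := mul_le_mul_of_nonneg_left hin (sq_nonneg (N : ℝ))
        have p2 := mul_le_mul_of_nonneg_right hN2 hin0
        linarith
    _ = κ₁ ^ 2 * J ^ 2 * X ^ 3 * (2 * A' + c₇ + 4 * C * τ) := by ring
    _ ≤ κ₁ ^ 2 * J ^ 2 * (ℓ ^ 3 * logPlus J ^ 3) * (2 * A' + c₇ + 4 * C * τ) := by
        have hpos : 0 ≤ 2 * A' + c₇ + 4 * C * τ := by positivity
        have := mul_le_mul_of_nonneg_left hX3J (by positivity : 0 ≤ κ₁ ^ 2 * J ^ 2)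
        exact mul_le_mul_of_nonneg_right this hpos
    _ = 3 * ((κ₁ ^ 2 * ℓ ^ 3 / 3 * (2 * A' + c₇ + 4 * C * τ)) * J ^ 2 * logPlus J ^ 3) := by ring


/-- **Block-general weak energy bound** (house form of Prop. 15 for the ordered pairs of any block
`[J, κJ]_{ℤ*}`, `κ ≥ 2`, as a Fubini consumer of §7 needs): on `[t₁, t₂]` above a real-rooted time,
under the location law (50), `∫_{t₁}^{t₂} Σ_{[J,κJ]_{ℤ*}.offDiag} E_{jk}(t) dt ≤ M₀ J² log₊^α J` for all
real `J ≥ 1` (`M₀ ≥ 0` depending on `κ` and the data, `α = 3`), with the per-zero far-field constant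
kept explicit. [cite: RodgersTaoFMP2020, Prop. 15 = v4 Prop. 6.1, p. 38; proof pp. 38–39] -/
theorem rodgers_tao_weak_energy_bound_block_of_far {t₀ t₁ t₂ B C D : ℝ}
    (hreal : HasOnlyRealZeros (deBruijnH t₀)) (ht₀ : t₀ < t₁) (h12 : t₁ < t₂)
    (H2 : ∀ t ∈ Icc t₁ t₂, ∀ n : ℕ, 1 ≤ n →
      |deBruijnZero t n - classicalLocation (n : ℝ)| ≤ B * logPlus (classicalLocation (n : ℝ)))
    (hC : 0 ≤ C) (hD : 1 ≤ D) {κ : ℝ} (hκ : 2 ≤ κ)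
    (hfarC : ∀ t ∈ Icc t₁ t₂, ∀ (M L : ℕ) (k : ℤ), 2 ≤ k → k ≤ M → D * logPlus (M : ℝ) ^ 2 ≤ L →
      ∀ S : Finset ℤ, (∀ j ∈ S, j ≠ 0 ∧ (L : ℤ) ≤ |k - j|) →
        ∑ j ∈ S, interactionEnergy t j k ≤ C) :
    ∃ M₀ : ℝ, ∃ α : ℕ, 0 ≤ M₀ ∧ ∀ J : ℝ, 1 ≤ J →
      ∫ t in t₁..t₂, ∑ p ∈ (zstarIcc ⌈J⌉ ⌊κ * J⌋).offDiag, interactionEnergy t p.1 p.2 ≤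
        M₀ * J ^ 2 * logPlus J ^ α := by
  have h12' : t₁ ≤ t₂ := h12.le
  -- constants
  set B' : ℝ := max B 0 with hB'def
  have hB' : 0 ≤ B' := le_max_right _ _
  have H2' : ∀ t ∈ Icc t₁ t₂, ∀ n : ℕ, 1 ≤ n →
      |deBruijnZero t n - classicalLocation (n : ℝ)| ≤ B' * logPlus (classicalLocation (n : ℝ)) :=
    fun t ht n hn ↦ (H2 t ht n hn).trans
      (mul_le_mul_of_nonneg_right (le_max_left _ _) (logPlus_nonneg _))
  obtain ⟨A, hA⟩ := rodgers_tao_gap_bound_of ht₀ hreal H2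
  set A' : ℝ := max A 0 with hA'def
  have hA' : 0 ≤ A' := le_max_right _ _
  obtain ⟨c₀, C₀, hc₀, hcC, hord⟩ := lemma8_i_order
  have hC₀ : 0 < C₀ := lt_of_lt_of_le hc₀ hcC
  set Cstar : ℝ := 4 + 4 * D + 64 * D ^ 2 * (26 + 4 * B' * C₀ + 4 * A') with hCstar
  have hκ1 : (1 : ℝ) ≤ κ + 2 := by linarith
  obtain ⟨J₁, hJ₁⟩ := exists_mul_log_mul_pow_seven_lt Cstar hκ1
  set Jstar : ℝ := max 4 J₁ with hJstar
  set M₁ : ℝ := (κ + 1) ^ 2 * (Real.log (κ + 1) + 1) ^ 3 / 3 *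
    (2 * A' + (|Real.log (2 * C₀ * (1 + B'))| + 1) + 4 * C * (t₂ - t₁)) with hM₁
  have hM₁0 : 0 ≤ M₁ := by
    have : 0 ≤ C * (t₂ - t₁) := mul_nonneg hC (by linarith)
    have : 0 ≤ Real.log (κ + 1) := Real.log_nonneg (by linarith)
    rw [hM₁]; positivity
  set N₁ : ℕ := ⌊κ * Jstar⌋₊ + 1 with hN₁
  have hint : ∀ S : Finset ℤ, IntervalIntegrable
      (fun t ↦ ∑ p ∈ S.offDiag, interactionEnergy t p.1 p.2) volume t₁ t₂ := fun S ↦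
    ((continuousOn_sum_offDiag_interactionEnergy hreal ht₀ S).mono (by rw [uIcc_of_le h12'])).intervalIntegrable
  set Q₁ : ℝ := ∫ t in t₁..t₂, ∑ p ∈ (zstarIcc 1 N₁).offDiag, interactionEnergy t p.1 p.2 with hQ₁
  have hQ₁ : 0 ≤ Q₁ := intervalIntegral.integral_nonneg h12' fun t _ ↦
    Finset.sum_nonneg fun _ _ ↦ interactionEnergy_nonneg _ _ _
  refine ⟨M₁ + Q₁, 3, by linarith, fun J hJ1 ↦ ?_⟩
  have hJJ : 1 ≤ J ^ 2 * logPlus J ^ 3 := by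
    have h1 : 1 ≤ J ^ 2 := by nlinarith
    have h2 : 1 ≤ logPlus J := by
      rw [logPlus, abs_of_nonneg (by linarith)]
      have : Real.exp 1 ≤ 2 + J := by linarith [Real.exp_one_lt_d9]
      calc (1 : ℝ) = Real.log (Real.exp 1) := (Real.log_exp 1).symm
        _ ≤ Real.log (2 + J) := Real.log_le_log (Real.exp_pos 1) this
    nlinarith [one_le_pow₀ (n := 3) h2]
  have hJJ0 : 0 ≤ J ^ 2 * logPlus J ^ 3 := zero_le_one.trans hJJ
  have hceil1 : (1 : ℤ) ≤ ⌈J⌉ := by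
    have : (0 : ℤ) < ⌈J⌉ := Int.lt_ceil.2 (by push_cast; linarith)
    omega
  have hfin : ∀ Q : ℝ, Q ≤ Q₁ ∨ Q ≤ M₁ * J ^ 2 * logPlus J ^ 3 →
      Q ≤ (M₁ + Q₁) * J ^ 2 * logPlus J ^ 3 := by
    intro Q hQ
    have e : (M₁ + Q₁) * J ^ 2 * logPlus J ^ 3 =
        M₁ * (J ^ 2 * logPlus J ^ 3) + Q₁ * (J ^ 2 * logPlus J ^ 3) := by ring
    have p1 : Q₁ * 1 ≤ Q₁ * (J ^ 2 * logPlus J ^ 3) := mul_le_mul_of_nonneg_left hJJ hQ₁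
    have p2 : 0 ≤ M₁ * (J ^ 2 * logPlus J ^ 3) := mul_nonneg hM₁0 hJJ0
    have p3 : 0 ≤ Q₁ * (J ^ 2 * logPlus J ^ 3) := mul_nonneg hQ₁ hJJ0
    have e2 : M₁ * J ^ 2 * logPlus J ^ 3 = M₁ * (J ^ 2 * logPlus J ^ 3) := by ring
    rw [e]
    rcases hQ with hQ | hQ
    · linarith only [hQ, p1, p2]
    · rw [e2] at hQ; linarith only [hQ, p3]
  rcases lt_or_ge J Jstar with hsmall | hlarge
  · -- small `J`: `[⌈J⌉, ⌊2J⌋]_{ℤ*} ⊆ [1, N₁]_{ℤ*}`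
    have hb : ⌊κ * J⌋ < (N₁ : ℤ) := by
      have h1 : (⌊κ * J⌋ : ℝ) ≤ κ * J := Int.floor_le _
      have h2 : κ * Jstar < (N₁ : ℝ) := by
        rw [hN₁]; push_cast; linarith only [Nat.lt_floor_add_one (κ * Jstar)]
      have h4 : κ * J ≤ κ * Jstar := mul_le_mul_of_nonneg_left hsmall.le (by linarith)
      have h3 : (⌊κ * J⌋ : ℝ) < (N₁ : ℝ) := by linarith only [h1, h2, h4]
      exact_mod_cast h3
    have hsub : zstarIcc ⌈J⌉ ⌊κ * J⌋ ⊆ zstarIcc 1 N₁ := fun j hj ↦ by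
      obtain ⟨hj0, hja, hjb⟩ := mem_zstarIcc.1 hj
      exact mem_zstarIcc.2 ⟨hj0, by omega, by omega⟩
    have hmono : ∫ t in t₁..t₂, ∑ p ∈ (zstarIcc ⌈J⌉ ⌊κ * J⌋).offDiag, interactionEnergy t p.1 p.2 ≤ Q₁ :=
      intervalIntegral_sum_offDiag_mono hsub h12'
        (fun t _ x _ y _ _ ↦ interactionEnergy_nonneg t x y) (hint _) (hint _)
    exact hfin _ (Or.inl hmono)
  · -- large `J`: the chain
    have hJ4 : 4 ≤ J := le_trans (le_max_left _ _) hlarge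
    have hJ2 : 2 ≤ J := by linarith
    have hJ₁J : J₁ ≤ J := le_trans (le_max_right _ _) hlarge
    have hbig : Cstar * Real.log ((κ + 2) * J) ^ 7 < J := hJ₁ J hJ₁J hJ2
    have hbig' : Cstar * Real.log ((κ + 1 + 1) * J) ^ 7 < J := by
      rw [show κ + 1 + 1 = κ + 2 by ring]; exact hbig
    have hκ3 : 3 ≤ κ + 1 := by linarith
    set N : ℕ := ⌊(κ + 1) * J⌋₊ with hNdef
    have hκJ0 : 0 ≤ (κ + 1) * J := by positivity
    have hNJ : (N : ℝ) ≤ (κ + 1) * J := Nat.floor_le hκJ0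
    have hNJ' : (κ + 1) * J < (N : ℝ) + 1 := Nat.lt_floor_add_one _
    have h6 : (6 : ℝ) ≤ (κ + 1) * J := by
      have : 3 * J ≤ (κ + 1) * J := mul_le_mul_of_nonneg_right (by linarith) (by linarith)
      linarith
    have hN6 : 6 ≤ N := Nat.le_floor (by exact_mod_cast h6)
    have hN1 : (1 : ℝ) ≤ N := by exact_mod_cast (by omega : 1 ≤ N)
    have hXpos : 0 < D * logPlus (N : ℝ) ^ 2 := by
      have : 0 < logPlus (N : ℝ) := logPlus_pos _
      positivity
    set L : ℕ := ⌈D * logPlus (N : ℝ) ^ 2⌉₊ with hLdef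
    have hLge : D * logPlus (N : ℝ) ^ 2 ≤ (L : ℝ) := Nat.le_ceil _
    have hLlt : (L : ℝ) < D * logPlus (N : ℝ) ^ 2 + 1 := Nat.ceil_lt_add_one hXpos.le
    have hL1 : 1 ≤ L := Nat.one_le_iff_ne_zero.2 (Nat.pos_iff_ne_zero.1 (Nat.ceil_pos.2 hXpos))
    have hL0 : (0 : ℝ) < L := by exact_mod_cast hL1
    have hy0 : 0 ≤ (J / 2 - 2) / L := div_nonneg (by linarith) hL0.le
    set m : ℕ := ⌊(J / 2 - 2) / L⌋₊ with hmdef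
    have hmle : (m : ℝ) ≤ (J / 2 - 2) / L := Nat.floor_le hy0
    have hmlt : (J / 2 - 2) / L < (m : ℝ) + 1 := Nat.lt_floor_add_one _
    have hmL : (m : ℝ) * L ≤ J / 2 - 2 := (le_div_iff₀ hL0).1 hmle
    -- the integer side conditions
    have hceil : (J : ℝ) ≤ ⌈J⌉ := Int.le_ceil J
    have hceil' : (⌈J⌉ : ℝ) < J + 1 := Int.ceil_lt_add_one J
    have hfloor : (⌊κ * J⌋ : ℝ) ≤ κ * J := Int.floor_le _
    have hfloor' : κ * J < (⌊κ * J⌋ : ℝ) + 1 := Int.lt_floor_add_one _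
    have hκJ2 : 2 * J ≤ κ * J := mul_le_mul_of_nonneg_right hκ (by linarith)
    have ha : (2 : ℤ) ≤ ⌈J⌉ - (m : ℤ) * L := by
      have : (2 : ℝ) ≤ (⌈J⌉ : ℝ) - (m : ℝ) * L := by linarith only [hceil, hmL, hJ4]
      exact_mod_cast this
    have hab : ⌈J⌉ < ⌊κ * J⌋ := by
      have : (⌈J⌉ : ℝ) < (⌊κ * J⌋ : ℝ) := by linarith only [hceil', hfloor', hJ4, hκJ2]
      exact_mod_cast this
    have hbN : ⌊κ * J⌋ + (m : ℤ) * L ≤ (N : ℤ) := by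
      have e : (κ + 1) * J = κ * J + J := by ring
      have : (⌊κ * J⌋ : ℝ) + (m : ℝ) * L ≤ (N : ℝ) := by linarith only [hfloor, hmL, hNJ', hJ4, e]
      exact_mod_cast this
    have hfar : ∀ t ∈ Icc t₁ t₂, ∀ k : ℤ, 2 ≤ k → k ≤ N → ∀ S : Finset ℤ,
        (∀ j ∈ S, j ≠ 0 ∧ (L : ℤ) ≤ |k - j|) → ∑ j ∈ S, interactionEnergy t j k ≤ C :=
      fun t ht k hk2 hkN S hS ↦ hfarC t ht N L k hk2 hkN hLge S hS
    have hordN : logPlus (classicalLocation N) ≤ C₀ * logPlus N := (hord N hN1).2.2.2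
    have hξN : classicalLocation N ≤ C₀ * (N / logPlus N) := (hord N hN1).2.1
    have hgrow := growth_of_large_block hB' hA' hC₀ hD hordN hN6 hNJ hJ4 hL1 hLlt.le
      (by linarith only [hmlt]) hbig'
    have hchain := three_mul_integral_le_of_chain hreal ht₀ h12 hB' H2' hA hL1 ha hab hbN hfar hgrow
    have hrhs := chain_rhs_le_block hB' hA' hC₀ hC (by linarith : 0 ≤ t₂ - t₁) hJ2 hκ3 hN6 hNJ hξN hordN
      (A' := A')
    rw [← hM₁] at hrhs
    have h3 := hchain.trans hrhs
    exact hfin _ (Or.inr (by linarith only [h3]))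

/-- **Block-general weak energy bound** (Prop. 15 CONTENT twin for `[J, κJ]_{ℤ*}`, `κ ≥ 2`): on
`[t₁, t₂]` above a real-rooted time `t₀ < t₁`, under the location law (50) on `[t₁, t₂]`,
`∃ M₀ ≥ 0, α, ∀ J ≥ 1, ∫_{t₁}^{t₂} Σ_{[⌈J⌉,⌊κJ⌋]_{ℤ*}.offDiag} E_{jk}(t) dt ≤ M₀ J² log₊^α J`.
[cite: RodgersTaoFMP2020, Prop. 15 = v4 Prop. 6.1, p. 38; proof pp. 38–39; §7 p. 42] -/
theorem rodgers_tao_weak_energy_bound_block_of {t₀ t₁ t₂ B : ℝ}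
    (hreal : HasOnlyRealZeros (deBruijnH t₀)) (ht₀ : t₀ < t₁) (h12 : t₁ < t₂)
    (H2 : ∀ t ∈ Icc t₁ t₂, ∀ n : ℕ, 1 ≤ n →
      |deBruijnZero t n - classicalLocation (n : ℝ)| ≤ B * logPlus (classicalLocation (n : ℝ)))
    {κ : ℝ} (hκ : 2 ≤ κ) :
    ∃ M₀ : ℝ, ∃ α : ℕ, 0 ≤ M₀ ∧ ∀ J : ℝ, 1 ≤ J →
      ∫ t in t₁..t₂, ∑ p ∈ (zstarIcc ⌈J⌉ ⌊κ * J⌋).offDiag, interactionEnergy t p.1 p.2 ≤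
        M₀ * J ^ 2 * logPlus J ^ α := by
  obtain ⟨C, D, hC, hD, hfar⟩ := exists_far_interactionEnergy_sum_le (t₂ := t₂) hreal ht₀ H2
  exact rodgers_tao_weak_energy_bound_block_of_far hreal ht₀ h12 H2 hC hD hκ hfar

end Literature.NumberTheory.LFunctions

end
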